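import Summits.BirchSwinnertonDyer.Rank1Residual.P2.CMKolyvaginOddManinTwistRoadAtTwoClasses
import Summits.BirchSwinnertonDyer.Rank1Residual.P2.CMKolyvaginHabitatInertAtlas
import Summits.BirchSwinnertonDyer.Rank1Residual.P2.CMKolyvaginHabitatTwentySevenA4AtTwo
import HarnessLib

/-!
# Route `ShiftedKolyvaginAtInertTwo` (leaf `WAllCornerFTwo`), aside `OddManinCMInertTwoR`
# (stmt-BirchSwinnertonDyer-26780) ON THE WHOLE CM-INERT-AT-2 ATLAS: everything but `j = 0` is a
# theorem modulo the printed Manin facts, and the `j = 0` residual is bsd-f2-manin's crux by name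

Cell `bsd-print-cf2`, seat ty2 (discharge interface). Third file of the twist road
(`CMKolyvaginOddManinTwistRoadAtTwo.lean` = the engine, `…Classes.lean` = the five odd-Heegner classes).
HONEST FRAMING: THEOREMS ONLY — no definition, no named fact, no route file imported, nothing about BSD
asserted or booked; the leaf, the route's research cruxes, item 26780 AS TYPED and Manin's conjecture
are OPEN; BSD is NOT proved by any of this.

Item 26780 as typed quantifies over every globally minimal `W/ℚ` with CM, `2` inert in the CM field,
`ρ̄_{W,2}` onto `GL₂(𝔽₂)` and analytic rank `1`, and asks that every lattice-optimal `X₀(N_W)`-datum has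
odd Manin constant `c`. By the tree's atlas `CornerFTwo.inertAtlas` such a `W` is a `ℚ`-model of
(a) `y² = x³ + k`, (b) a twist of the `j = 54000` curve, (c) a square-free twist of `27a4`
(`j = −12288000`), or (d)–(h) a square-free twist of `121b1, 361a1, 1849a1, 4489a1, 26569a1`.

* §5 `odd_c_of_latticeOptimal_of_maninOddAtFour` — for EVERY globally minimal `W/ℚ` and every
  lattice-optimal datum at any level, `c` is odd, GIVEN the three printed prime-wise facts (Mazur 1978
  Cor. 4.1, Abbes–Ullmo 1996 Thm. A, Česnavičius 2018 Thm. 1.2), modularity, and the BODY (verbatim,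
  definitionally equal) of cell bsd-f2-manin's registered crux
  `Summit.BirchSwinnertonDyer.BirchSwinnertonDyer.Theses.ManinLocalTwoThree.ManinOddAtFour`
  (stmt-BirchSwinnertonDyer-22967: `4 ∣ N ⟹ 2 ∤ c`); `oddManinCMInertTwoR_of_print_of_maninOddAtFour`
  is item 26780 VERBATIM from the same binders (so `hMan := … hMz hAU hC2 hmod h22967` in `closes`).
* §6 row (c): `odd_c_of_latticeOptimal_of_smul_eq_curve27a4_quadraticTwist`,
  `odd_c_of_latticeOptimal_of_j_eq_neg_12288000` — the engine with base `27a4` (good at `2`).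
* §7 THE ATLAS DOOR `odd_c_of_latticeOptimal_of_cmInert_two_of_j_ne_zero`: CM, `2` inert, `ρ̄₂` onto,
  `j ≠ 0` ⟹ every lattice-optimal datum at any level has odd `c`, modulo the four prints (rows (c)–(h)
  by the engine, row (b) is empty by `InertAtlas.not_hasSurjectiveModNGaloisRep_two_of_j_eq_54000`).
* §8 item 26780 VERBATIM ⟸ the four prints + ONE residual hypothesis on the `j = 0` sector, in two
  strengths: `oddManinCMInertTwoR_of_print_of_jZero` (residual = 26780 restricted to `j = 0`) and
  `oddManinCMInertTwoR_of_print_of_jZero_twistMinimal` (residual = `j = 0` AND `W` is not a `ℚ`-model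
  of a square-free quadratic twist of a globally minimal curve good at `2` — the engine eats the rest);
  both residuals are sub-cases of crux 22967 (`jZero_twistMinimal_residual_of_maninOddAtFour`).

What is NOT here: no proof of anything on the `j = 0` twist-minimal sector (curves `y² = x³ + k` with
`v₂(k) mod 6 ∈ {0, 2, 3, 5}` up to sixth powers: additive at `2`, not a dyadic twist of a `2`-semistable
class; no printed theorem controls `ord₂(c)` there beyond Cremona's tables) — that is cell
bsd-f2-manin's open core (`Cruxes/ManinOddAtFour`, stub `stub_twistMinimalAtTwo`).

References: [Mazur1978] Cor. 4.1; [AbbesUllmo1996] Thm. A; [Cesnavicius2018] Thm. 1.2; [Stevens1989]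
Lemmas (5.2), (5.4); [BarriosEtAl2025] Thm. 5.1; [SilvermanAEC2009] X.5 Prop. 5.4, Cor. 5.4.1;
[SilvermanATAEC1994] App. A §3; [Cremona1997] Table 1 (27a4, 36a1, 121b1, 361a1, 1849a1, 4489a1, 26569a1);
[DokchitserDokchitserMathZ2012] Theorem (1).
-/

set_option autoImplicit false

noncomputable section

open scoped Classical NumberField

open WeierstrassCurve NumberField Literature.NumberTheory.EllipticCurves
  Literature.NumberTheory.EllipticCurves.ModularForms Literature.NumberTheory.EllipticCurves.Rank1Residual
  Literature.NumberTheory.EllipticCurves.Rank1Residual.X11RankOneCertificates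
  Summit.BirchSwinnertonDyer.Rank1Residual Summit.BirchSwinnertonDyer.Rank1Residual.X11b
  Summit.BirchSwinnertonDyer.Rank1Residual.P2

namespace Summit.BirchSwinnertonDyer.Rank1Residual.P2.OddManinTwistRoad

/-! ## §5 Every optimal curve has odd Manin constant, GIVEN the prints and crux `ManinOddAtFour` -/

/-- **Manin's conjecture at the prime `2` for optimal curves, relative to the prints and to
bsd-f2-manin's crux.** For every globally minimal `W/ℚ`, every level `N` and every `X₀(N)`-datum `Dt`
with `Λ_W ⊆ c·Λ_f`: `c` is odd — GIVEN Mazur 1978 Cor. 4.1 (`hM`), Abbes–Ullmo 1996 Thm. A (`hAU`: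
`2 ∤ N ⟹ 2 ∤ c`), Česnavičius 2018 Thm. 1.2 (`hC2`: `2 ∥ N ⟹ 2 ∤ c`), modularity (`hnf`) and `h4` =
the body, verbatim, of the registered crux `Theses.ManinLocalTwoThree.ManinOddAtFour`
(stmt-BirchSwinnertonDyer-22967: `4 ∣ N ⟹ 2 ∤ c`; pass the route decl by name, it unfolds
definitionally). Case split on `ord₂(N) = 0, 1, ≥ 2`. [cite: AbbesUllmo1996, Thm. A]
[cite: Cesnavicius2018, Thm. 1.2] [cite: Mazur1978, Cor. 4.1] -/
theorem odd_c_of_latticeOptimal_of_maninOddAtFour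
    (hM : mazur_not_dvd_maninConstant_of_odd)
    (hAU : abbesUllmo_not_dvd_maninConstant_of_not_dvd_level)
    (hC2 : cesnavicius_not_two_dvd_maninConstant_of_two_dvd_level) (hnf : exists_isNewformOf)
    (h4 : mazur_not_dvd_maninConstant_of_odd → abbesUllmo_not_dvd_maninConstant_of_not_dvd_level →
      cesnavicius_not_two_dvd_maninConstant_of_two_dvd_level → exists_isNewformOf →
      ∀ (W : WeierstrassCurve ℚ) [W.IsElliptic] [W.IsGloballyMinimal] {N : ℕ} [NeZero N]
        (D : ModularParametrizationData W N),
        (∀ z ∈ D.L.lattice, ∃ w ∈ periodLattice D.f, z = D.c * w) → 2 ^ 2 ∣ N →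
        ¬ (2 : ℤ) ∣ D.maninConstant)
    (W : WeierstrassCurve ℚ) [W.IsElliptic] [W.IsGloballyMinimal] {N : ℕ} [NeZero N]
    (Dt : ModularParametrizationData W N)
    (hopt : ∀ z ∈ Dt.L.lattice, ∃ w ∈ periodLattice Dt.f, z = (Dt.c : ℂ) * w) : Odd Dt.c := by
  have h : ¬ (2 : ℤ) ∣ Dt.maninConstant := by
    by_cases h4N : 2 ^ 2 ∣ N
    · exact h4 hM hAU hC2 hnf W Dt hopt h4N
    · by_cases h2N : 2 ∣ N
      · exact hC2 W Dt hopt h2N h4N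
      · exact hAU W Dt hopt 2 Nat.prime_two h2N
  exact Int.not_even_iff_odd.mp fun he ↦ h (even_iff_two_dvd.mp he)

/-- **ITEM 26780 `OddManinCMInertTwoR` VERBATIM, from the prints and crux 22967 by name.** The body
of the aside (route `ShiftedKolyvaginAtInertTwo`, rev 13) — binders `W.HasCM`, `CMInert W 2`,
`ρ̄_{W,2}` onto, `r_an = 1`, `Dt` at the conductor, lattice clause, `Odd Dt.c` — from `hM hAU hC2 hnf`
and `h4 : ManinOddAtFour` (unfolded); the habitat binders are not used. In `closes`:
`hMan := oddManinCMInertTwoR_of_print_of_maninOddAtFour hMz hAU hC2 hmod h22967`.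
[cite: AbbesUllmo1996, Thm. A] [cite: Cesnavicius2018, Thm. 1.2] [cite: Mazur1978, Cor. 4.1] -/
theorem oddManinCMInertTwoR_of_print_of_maninOddAtFour
    (hM : mazur_not_dvd_maninConstant_of_odd)
    (hAU : abbesUllmo_not_dvd_maninConstant_of_not_dvd_level)
    (hC2 : cesnavicius_not_two_dvd_maninConstant_of_two_dvd_level) (hnf : exists_isNewformOf)
    (h4 : mazur_not_dvd_maninConstant_of_odd → abbesUllmo_not_dvd_maninConstant_of_not_dvd_level →
      cesnavicius_not_two_dvd_maninConstant_of_two_dvd_level → exists_isNewformOf →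
      ∀ (W : WeierstrassCurve ℚ) [W.IsElliptic] [W.IsGloballyMinimal] {N : ℕ} [NeZero N]
        (D : ModularParametrizationData W N),
        (∀ z ∈ D.L.lattice, ∃ w ∈ periodLattice D.f, z = D.c * w) → 2 ^ 2 ∣ N →
        ¬ (2 : ℤ) ∣ D.maninConstant) :
    ∀ (W : WeierstrassCurve ℚ) [W.IsElliptic] [W.IsGloballyMinimal] [NeZero (W.conductorNorm ℤ)],
      W.HasCM → Literature.NumberTheory.EllipticCurves.Rank1Residual.CMInert W 2 →
      W.HasSurjectiveModNGaloisRep (2 : ℤ) → W.analyticRank = 1 →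
      ∀ (Dt : ModularParametrizationData W (W.conductorNorm ℤ)),
        (∀ z ∈ Dt.L.lattice, ∃ w ∈ periodLattice Dt.f, z = (Dt.c : ℂ) * w) → Odd Dt.c :=
  fun W _ _ _ _ _ _ _ Dt hopt ↦ odd_c_of_latticeOptimal_of_maninOddAtFour hM hAU hC2 hnf h4 W Dt hopt

/-! ## §6 Row (c) of the atlas: the square-free twists of `27a4` (`j = −12288000`) -/

/-- **Row (c): every globally minimal `ℚ`-model `W` of `27a4^{(d)}`, `d ≠ 0` square-free, and every
lattice-optimal `X₀`-datum of `W` at any level: `c` is odd**, modulo `hM hAU hC2 hnf` — the engine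
`odd_c_of_latticeOptimal_of_smul_eq_quadraticTwist_of_hasGoodReductionAtPrime_two` with base
`27a4 : y² + y = x³ − 30x + 63` (globally minimal, `Δ = −3⁵`, good at `2`).
[cite: Cremona1997, Table 1 (27a4)] [cite: Stevens1989, Lemmas (5.2), (5.4)] [cite: Cesnavicius2018, Thm. 1.2]
[cite: AbbesUllmo1996, Thm. A] [cite: BarriosEtAl2025, Thm. 5.1] -/
theorem odd_c_of_latticeOptimal_of_smul_eq_curve27a4_quadraticTwist
    (hM : mazur_not_dvd_maninConstant_of_odd)
    (hAU : abbesUllmo_not_dvd_maninConstant_of_not_dvd_level)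
    (hC2 : cesnavicius_not_two_dvd_maninConstant_of_two_dvd_level) (hnf : exists_isNewformOf)
    {d : ℤ} (hd0 : d ≠ 0) (hsq : Squarefree d)
    (W : WeierstrassCurve ℚ) [W.IsElliptic] [W.IsGloballyMinimal] {C : VariableChange ℚ}
    (hC : C • W = (⟨0, 0, 1, -30, 63⟩ : WeierstrassCurve ℚ).quadraticTwist (d : ℚ))
    {N : ℕ} [NeZero N] (Dt : ModularParametrizationData W N)
    (hopt : ∀ z ∈ Dt.L.lattice, ∃ w ∈ periodLattice Dt.f, z = (Dt.c : ℂ) * w) : Odd Dt.c := by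
  haveI := isElliptic_curve27a4
  haveI := TwentySevenA4.isGloballyMinimal_curve27a4
  exact odd_c_of_latticeOptimal_of_smul_eq_quadraticTwist_of_hasGoodReductionAtPrime_two hM hAU hC2 hnf
    TwentySevenA4.hasGoodReductionAtPrime_two_curve27a4 hd0 hsq W hC Dt hopt

/-- **Row (c) in `j`-currency: `W` globally minimal with `j(W) = −12288000 = −2¹⁵·3·5³`** (the class of
`27a4` and all its quadratic twists; CM by `ℤ[3ω]`, `2` inert) ⟹ every lattice-optimal datum of `W` at
any level has odd `c`, modulo `hM hAU hC2 hnf`. [cite: SilvermanATAEC1994, App. A §3 (row D = −27)]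
[cite: SilvermanAEC2009, X.5 Cor. 5.4.1] [cite: Stevens1989, Lemmas (5.2), (5.4)] [cite: AbbesUllmo1996, Thm. A] -/
theorem odd_c_of_latticeOptimal_of_j_eq_neg_12288000
    (hM : mazur_not_dvd_maninConstant_of_odd)
    (hAU : abbesUllmo_not_dvd_maninConstant_of_not_dvd_level)
    (hC2 : cesnavicius_not_two_dvd_maninConstant_of_two_dvd_level) (hnf : exists_isNewformOf)
    (W : WeierstrassCurve ℚ) [W.IsElliptic] [W.IsGloballyMinimal] (hj : W.j = -12288000)
    {N : ℕ} [NeZero N] (Dt : ModularParametrizationData W N)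
    (hopt : ∀ z ∈ Dt.L.lattice, ∃ w ∈ periodLattice Dt.f, z = (Dt.c : ℂ) * w) : Odd Dt.c := by
  haveI := isElliptic_curve27a4
  haveI := TwentySevenA4.isGloballyMinimal_curve27a4
  exact odd_c_of_latticeOptimal_of_j_eq_of_hasGoodReductionAtPrime_two hM hAU hC2 hnf
    (⟨0, 0, 1, -30, 63⟩ : WeierstrassCurve ℚ) TwentySevenA4.hasGoodReductionAtPrime_two_curve27a4
    (by rw [j_curve27a4]; norm_num) (by rw [j_curve27a4]; norm_num) W (hj.trans j_curve27a4.symm) Dt hopt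

/-! ## §7 The atlas door: CM, `2` inert, `ρ̄₂` onto, `j ≠ 0` -/

/-- A `ℚ`-model of `y² = x³ + k` has `j = 0` (`c₄ = 0`). [cite: SilvermanAEC2009, X.5 Prop. 5.4 (iii)] -/
theorem j_eq_zero_of_smul_mordell_eq (W : WeierstrassCurve ℚ) [W.IsElliptic] {k : ℤ}
    {C : VariableChange ℚ} (hC : C • (⟨0, 0, 0, 0, (k : ℚ)⟩ : WeierstrassCurve ℚ) = W) : W.j = 0 := by
  have hc4 : W.c₄ = 0 := by
    rw [← hC, variableChange_c₄, c₄_mk_a₆, mul_zero]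
  rw [WeierstrassCurve.j, hc4]
  ring

/-- A `ℚ`-model of a twist of the `j = 54000` base `y² = x³ + 6x² − 3x` (`d ≠ 0`) has `j = 54000`.
[cite: SilvermanATAEC1994, App. A §3 (row D = −12)] -/
theorem j_eq_54000_of_smul_twist_eq (W : WeierstrassCurve ℚ) [W.IsElliptic] {d : ℤ} (hd : d ≠ 0)
    {C : VariableChange ℚ}
    (hC : C • (⟨0, 6, 0, -3, 0⟩ : WeierstrassCurve ℚ).quadraticTwist (d : ℚ) = W) : W.j = 54000 := by
  have hdq : (d : ℚ) ≠ 0 := by exact_mod_cast hd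
  haveI := isElliptic_of_discOf_ne_zero 0 6 0 (-3) 0 (by decide)
  have h := CornerFTwo.Atlas.j_eq_of_smul_twist (W := W)
    (E := ⟨((0 : ℤ) : ℚ), ((6 : ℤ) : ℚ), ((0 : ℤ) : ℚ), ((-3 : ℤ) : ℚ), ((0 : ℤ) : ℚ)⟩) hdq
    (C := C) (by push_cast; exact hC)
  rw [h]; push_cast; exact j_cm12

/-- **THE ATLAS DOOR.** For `W/ℚ` globally minimal with CM, `2` INERT in the CM field, `ρ̄_{W,2}` onto
`GL₂(𝔽₂)` and `j(W) ≠ 0`, EVERY lattice-optimal `X₀(N)`-datum `Dt` of `W` at any level has ODD `c` —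
modulo Mazur 1978 Cor. 4.1 (`hM`), Abbes–Ullmo 1996 Thm. A (`hAU`), Česnavičius 2018 Thm. 1.2 (`hC2`)
and modularity (`hnf`), by name. Proof: the atlas `CornerFTwo.inertAtlas`; row (a) is excluded by
`j ≠ 0`, row (b) (`j = 54000`, rational `2`-torsion) by the image binder, rows (c)–(h) are square-free
twists of the globally minimal bases `27a4, 121b1, 361a1, 1849a1, 4489a1, 26569a1`, all good at `2`:
the engine. [cite: SilvermanAEC2009, X.5 Prop. 5.4 and Cor. 5.4.1] [cite: Cremona1997, Table 1]
[cite: DokchitserDokchitserMathZ2012, Theorem (1)] [cite: Stevens1989, Lemmas (5.2), (5.4)]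
[cite: Cesnavicius2018, Thm. 1.2] [cite: AbbesUllmo1996, Thm. A] [cite: BarriosEtAl2025, Thm. 5.1] -/
theorem odd_c_of_latticeOptimal_of_cmInert_two_of_j_ne_zero
    (hM : mazur_not_dvd_maninConstant_of_odd)
    (hAU : abbesUllmo_not_dvd_maninConstant_of_not_dvd_level)
    (hC2 : cesnavicius_not_two_dvd_maninConstant_of_two_dvd_level) (hnf : exists_isNewformOf)
    (W : WeierstrassCurve ℚ) [W.IsElliptic] [W.IsGloballyMinimal] (hCM : W.HasCM) (hin : CMInert W 2)
    (hρ : W.HasSurjectiveModNGaloisRep (2 : ℤ)) (hj0 : W.j ≠ 0)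
    {N : ℕ} [NeZero N] (Dt : ModularParametrizationData W N)
    (hopt : ∀ z ∈ Dt.L.lattice, ∃ w ∈ periodLattice Dt.f, z = (Dt.c : ℂ) * w) : Odd Dt.c := by
  rcases CornerFTwo.inertAtlas (W := W) hCM hin with
      ⟨k, _, C, hC⟩ | ⟨d, hd, _, C, hC⟩ | ⟨d, hd, hsq, C, hC⟩ | ⟨d, hd, hsq, C, hC⟩ |
      ⟨d, hd, hsq, C, hC⟩ | ⟨d, hd, hsq, C, hC⟩ | ⟨d, hd, hsq, C, hC⟩ | ⟨d, hd, hsq, C, hC⟩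
  · -- row (a): `y² = x³ + k` has `j = 0`
    exact absurd (j_eq_zero_of_smul_mordell_eq W hC) hj0
  · -- row (b): `j = 54000`, `ρ̄₂` not onto
    exact absurd hρ (InertAtlas.not_hasSurjectiveModNGaloisRep_two_of_j_eq_54000 W
      (j_eq_54000_of_smul_twist_eq W hd hC))
  · -- row (c): `27a4^{(d)}`
    exact odd_c_of_latticeOptimal_of_smul_eq_curve27a4_quadraticTwist hM hAU hC2 hnf hd hsq W
      (C := C⁻¹) (by rw [← hC, inv_smul_smul]) Dt hopt
  · -- row (d): `121b1^{(d)}`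
    haveI : cm11.IsGloballyMinimal := OddHeegnerTwists.isGloballyMinimal_cm11
    exact odd_c_of_latticeOptimal_of_smul_eq_quadraticTwist_of_hasGoodReductionAtPrime_two hM hAU hC2 hnf
      CornerFTwo.Atlas.good_two_cm11 hd hsq W (C := C⁻¹) (by rw [← hC, inv_smul_smul]) Dt hopt
  · -- row (e): `361a1^{(d)}`
    haveI : cm19.IsGloballyMinimal := OddHeegnerTwists.isGloballyMinimal_cm19
    exact odd_c_of_latticeOptimal_of_smul_eq_quadraticTwist_of_hasGoodReductionAtPrime_two hM hAU hC2 hnf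
      CornerFTwo.Atlas.good_two_cm19 hd hsq W (C := C⁻¹) (by rw [← hC, inv_smul_smul]) Dt hopt
  · -- row (f): `1849a1^{(d)}`
    haveI : cm43.IsGloballyMinimal := OddHeegnerTwists.isGloballyMinimal_cm43
    exact odd_c_of_latticeOptimal_of_smul_eq_quadraticTwist_of_hasGoodReductionAtPrime_two hM hAU hC2 hnf
      CornerFTwo.Atlas.good_two_cm43 hd hsq W (C := C⁻¹) (by rw [← hC, inv_smul_smul]) Dt hopt
  · -- row (g): `4489a1^{(d)}`
    haveI : cm67.IsGloballyMinimal := OddHeegnerTwists.isGloballyMinimal_cm67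
    exact odd_c_of_latticeOptimal_of_smul_eq_quadraticTwist_of_hasGoodReductionAtPrime_two hM hAU hC2 hnf
      CornerFTwo.Atlas.good_two_cm67 hd hsq W (C := C⁻¹) (by rw [← hC, inv_smul_smul]) Dt hopt
  · -- row (h): `26569a1^{(d)}`
    haveI : cm163.IsGloballyMinimal := OddHeegnerTwists.isGloballyMinimal_cm163
    exact odd_c_of_latticeOptimal_of_smul_eq_quadraticTwist_of_hasGoodReductionAtPrime_two hM hAU hC2 hnf
      CornerFTwo.Atlas.good_two_cm163 hd hsq W (C := C⁻¹) (by rw [← hC, inv_smul_smul]) Dt hopt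

/-! ## §8 Item 26780 verbatim from the prints and ONE residual on the `j = 0` sector -/

/-- **ITEM 26780 ⟸ prints + the `j = 0` residual (coarse form).** The body of aside 26780 VERBATIM
follows from `hM hAU hC2 hnf` and `hJ0` = the same statement restricted to `j(W) = 0` (CM and
inertness at `2` dropped there: automatic at `j = 0`). The atlas door (§7) does everything else.
[cite: SilvermanAEC2009, X.5 Prop. 5.4] [cite: Stevens1989, Lemmas (5.2), (5.4)]
[cite: Cesnavicius2018, Thm. 1.2] [cite: AbbesUllmo1996, Thm. A] [cite: Mazur1978, Cor. 4.1] -/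
theorem oddManinCMInertTwoR_of_print_of_jZero
    (hM : mazur_not_dvd_maninConstant_of_odd)
    (hAU : abbesUllmo_not_dvd_maninConstant_of_not_dvd_level)
    (hC2 : cesnavicius_not_two_dvd_maninConstant_of_two_dvd_level) (hnf : exists_isNewformOf)
    (hJ0 : ∀ (W : WeierstrassCurve ℚ) [W.IsElliptic] [W.IsGloballyMinimal] [NeZero (W.conductorNorm ℤ)],
      W.j = 0 → W.HasSurjectiveModNGaloisRep (2 : ℤ) → W.analyticRank = 1 →
      ∀ (Dt : ModularParametrizationData W (W.conductorNorm ℤ)),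
        (∀ z ∈ Dt.L.lattice, ∃ w ∈ periodLattice Dt.f, z = (Dt.c : ℂ) * w) → Odd Dt.c) :
    ∀ (W : WeierstrassCurve ℚ) [W.IsElliptic] [W.IsGloballyMinimal] [NeZero (W.conductorNorm ℤ)],
      W.HasCM → Literature.NumberTheory.EllipticCurves.Rank1Residual.CMInert W 2 →
      W.HasSurjectiveModNGaloisRep (2 : ℤ) → W.analyticRank = 1 →
      ∀ (Dt : ModularParametrizationData W (W.conductorNorm ℤ)),
        (∀ z ∈ Dt.L.lattice, ∃ w ∈ periodLattice Dt.f, z = (Dt.c : ℂ) * w) → Odd Dt.c := by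
  intro W _ _ _ hCM hin hρ hr Dt hopt
  by_cases hj0 : W.j = 0
  · exact hJ0 W hj0 hρ hr Dt hopt
  · exact odd_c_of_latticeOptimal_of_cmInert_two_of_j_ne_zero hM hAU hC2 hnf W hCM hin hρ hj0 Dt hopt

/-- **ITEM 26780 ⟸ prints + the `j = 0` TWIST-MINIMAL residual (fine form).** The body of aside
26780 VERBATIM follows from `hM hAU hC2 hnf` and `hJ0'` = the statement restricted to globally minimal
`W` with `j(W) = 0` which are NOT a `ℚ`-model of a square-free quadratic twist `E^{(d)}` of a
globally minimal curve `E` good at `2` (for those the engine of the twist road applies: `d ≡ 1 (4)` ⟹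
`W` good at `2`, Abbes–Ullmo; else a dyadic twist of the good curve `E^{(m*)}`, Stevens + the `η = 2`
law). In Mordell currency the residual classes are `y² = x³ + k` with `v₂(k) mod 6 ∈ {0, 2, 3, 5}`
(informal remark, not used). [cite: Stevens1989, Lemmas (5.2), (5.4)] [cite: BarriosEtAl2025, Thm. 5.1]
[cite: Cesnavicius2018, Thm. 1.2] [cite: AbbesUllmo1996, Thm. A] [cite: Mazur1978, Cor. 4.1]
[cite: SilvermanAEC2009, X.5 Prop. 5.4] -/
theorem oddManinCMInertTwoR_of_print_of_jZero_twistMinimal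
    (hM : mazur_not_dvd_maninConstant_of_odd)
    (hAU : abbesUllmo_not_dvd_maninConstant_of_not_dvd_level)
    (hC2 : cesnavicius_not_two_dvd_maninConstant_of_two_dvd_level) (hnf : exists_isNewformOf)
    (hJ0' : ∀ (W : WeierstrassCurve ℚ) [W.IsElliptic] [W.IsGloballyMinimal] [NeZero (W.conductorNorm ℤ)],
      W.j = 0 →
      (∀ (E : WeierstrassCurve ℚ) [E.IsElliptic] [E.IsGloballyMinimal], E.HasGoodReductionAtPrime 2 →
        ∀ (d : ℤ), d ≠ 0 → Squarefree d → ∀ (C : VariableChange ℚ),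
          C • W ≠ E.quadraticTwist (d : ℚ)) →
      W.HasSurjectiveModNGaloisRep (2 : ℤ) → W.analyticRank = 1 →
      ∀ (Dt : ModularParametrizationData W (W.conductorNorm ℤ)),
        (∀ z ∈ Dt.L.lattice, ∃ w ∈ periodLattice Dt.f, z = (Dt.c : ℂ) * w) → Odd Dt.c) :
    ∀ (W : WeierstrassCurve ℚ) [W.IsElliptic] [W.IsGloballyMinimal] [NeZero (W.conductorNorm ℤ)],
      W.HasCM → Literature.NumberTheory.EllipticCurves.Rank1Residual.CMInert W 2 →
      W.HasSurjectiveModNGaloisRep (2 : ℤ) → W.analyticRank = 1 →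
      ∀ (Dt : ModularParametrizationData W (W.conductorNorm ℤ)),
        (∀ z ∈ Dt.L.lattice, ∃ w ∈ periodLattice Dt.f, z = (Dt.c : ℂ) * w) → Odd Dt.c := by
  intro W _ _ _ hCM hin hρ hr Dt hopt
  by_cases hj0 : W.j = 0
  · by_cases hex : ∃ (E : WeierstrassCurve ℚ) (_ : E.IsElliptic) (_ : E.IsGloballyMinimal),
        E.HasGoodReductionAtPrime 2 ∧ ∃ d : ℤ, d ≠ 0 ∧ Squarefree d ∧
          ∃ C : VariableChange ℚ, C • W = E.quadraticTwist (d : ℚ)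
    · obtain ⟨E, _, _, hE, d, hd0, hsq, C, hC⟩ := hex
      exact odd_c_of_latticeOptimal_of_smul_eq_quadraticTwist_of_hasGoodReductionAtPrime_two hM hAU hC2
        hnf hE hd0 hsq W hC Dt hopt
    · exact hJ0' W hj0 (fun E _ _ hE d hd0 hsq C hC ↦ hex ⟨E, ‹_›, ‹_›, hE, d, hd0, hsq, C, hC⟩)
        hρ hr Dt hopt
  · exact odd_c_of_latticeOptimal_of_cmInert_two_of_j_ne_zero hM hAU hC2 hnf W hCM hin hρ hj0 Dt hopt

/-- **Both residuals are sub-cases of crux 22967** (`ManinOddAtFour`, body verbatim as `h4`): the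
fine `j = 0` twist-minimal residual `hJ0'` of `oddManinCMInertTwoR_of_print_of_jZero_twistMinimal`
holds GIVEN the prints and `h4` (by §5; none of the extra binders is used). So item 26780 is closed
BY NAME the day stmt-BirchSwinnertonDyer-22967 is, and meanwhile its honest open part is exactly the
`j = 0` twist-minimal sector. [cite: AbbesUllmo1996, Thm. A] [cite: Cesnavicius2018, Thm. 1.2]
[cite: Mazur1978, Cor. 4.1] -/
theorem jZero_twistMinimal_residual_of_maninOddAtFour
    (hM : mazur_not_dvd_maninConstant_of_odd)
    (hAU : abbesUllmo_not_dvd_maninConstant_of_not_dvd_level)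
    (hC2 : cesnavicius_not_two_dvd_maninConstant_of_two_dvd_level) (hnf : exists_isNewformOf)
    (h4 : mazur_not_dvd_maninConstant_of_odd → abbesUllmo_not_dvd_maninConstant_of_not_dvd_level →
      cesnavicius_not_two_dvd_maninConstant_of_two_dvd_level → exists_isNewformOf →
      ∀ (W : WeierstrassCurve ℚ) [W.IsElliptic] [W.IsGloballyMinimal] {N : ℕ} [NeZero N]
        (D : ModularParametrizationData W N),
        (∀ z ∈ D.L.lattice, ∃ w ∈ periodLattice D.f, z = D.c * w) → 2 ^ 2 ∣ N →
        ¬ (2 : ℤ) ∣ D.maninConstant) :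
    ∀ (W : WeierstrassCurve ℚ) [W.IsElliptic] [W.IsGloballyMinimal] [NeZero (W.conductorNorm ℤ)],
      W.j = 0 →
      (∀ (E : WeierstrassCurve ℚ) [E.IsElliptic] [E.IsGloballyMinimal], E.HasGoodReductionAtPrime 2 →
        ∀ (d : ℤ), d ≠ 0 → Squarefree d → ∀ (C : VariableChange ℚ),
          C • W ≠ E.quadraticTwist (d : ℚ)) →
      W.HasSurjectiveModNGaloisRep (2 : ℤ) → W.analyticRank = 1 →
      ∀ (Dt : ModularParametrizationData W (W.conductorNorm ℤ)),
        (∀ z ∈ Dt.L.lattice, ∃ w ∈ periodLattice Dt.f, z = (Dt.c : ℂ) * w) → Odd Dt.c :=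
  fun W _ _ _ _ _ _ _ Dt hopt ↦ odd_c_of_latticeOptimal_of_maninOddAtFour hM hAU hC2 hnf h4 W Dt hopt

end Summit.BirchSwinnertonDyer.Rank1Residual.P2.OddManinTwistRoad

end
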